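/-
Copyright (c) 2026. All rights reserved.
Released under Apache 2.0 license as described in the file LICENSE.
-/
import Literature.MathematicalPhysics.QuantumFieldTheory.Balaban1983to89.Beta.BlochFibreUniqueness
import Literature.MathematicalPhysics.QuantumFieldTheory.Balaban1983to89.Beta.FibreInverseDecay
import Mathlib.LinearAlgebra.Matrix.NonsingularInverse
import Mathlib.LinearAlgebra.Matrix.ToLin
import Mathlib.Algebra.Group.AddChar

/-!
# The Bloch fibre MATRIX of the gauge-fixed block-averaged KKT system (β sub-cell, row an2, step (D4)(i))

HONEST FRAMING (cell charter, binding).  Discharging `BetaPertH` would make Bałaban's UV stability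
UNCONDITIONAL — a real constructive-QFT result; it is NOT the continuum limit and NOT the Clay problem.
This module is a KERNEL BOOKKEEPING LEAF of the route «(O1′) `AffineReproduction.InfiniteVolumeSpec`
instance by Bloch decomposition» (journal NOTE 02:48:00Z, route P1-K).  It asserts NOTHING about
Bałaban's papers, cites no fact, and every declaration is [folklore] finite-dimensional linear algebra.

## What is here

Fix `d` and a block size `N ≥ 1`.  The finite index type

  `Idx d N := (Fin d × TorusSite d N) ⊕ (TorusSite d N ⊕ Fin d)`

carries the BOX COORDINATES of one block: the values of a fine 1-form `A` on the box (first summand),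
the values of the gauge multiplier `μ` on the box (second) and the value of the coarse constraint
multiplier `φ` at the block's coarse site (third).  A CONFIGURATION `U : Cfg d N := ℤ^d → Idx d N → ℂ`
is box data on every block; it defines fields on `ℤ^d`

  `cfgA U κ x = U (quo N x) (κ, proj N x)`,  `cfgμ U x = U (quo N x) (proj N x)`,  `cfgφ U κ y = U y κ`,

and `cfgFun U : Idx d N → ℂ` is the RESIDUAL VECTOR, on the box of the origin, of the homogeneous
gauge-fixed block-averaged KKT system of `BlochFibreUniqueness.blochFibre_uniqueness` for these fields:

* EL rows (index `inl (κ, z)`): `curvAdj (curv A) κ x − adjContourSum N φ κ x − dz (codiff₁ (dz μ)) κ x`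
  at `x = repZ z`;
* G rows (index `inr (inl z)`, `z ≠ 0`): `Γ (repZ z) − Γ 0` with `Γ := codiff₁ (dz (codiff₁ A))`
  (the weak gauge: `Γ` constant on the block);
* the M row (index `inr (inl 0)`): `blockSum N μ 0` (multiplier normalisation);
* Q rows (index `inr (inr κ)`): `contourSum N A κ 0` (block averages).

The system is SQUARE by construction (`d·N^d + N^d + d` unknowns and equations per block).  For a
coefficient function `c : ℤ^d → ℂ` the TENSOR configuration `tens c v = (q ↦ c q · v)` gives the fibre map
`fibreLin c : v ↦ cfgFun (tens c v)` and its matrix `fibreMatrix c`; for a multiplicative character `χ`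
the fields of `tens χ v` are exactly the `χ`-Bloch fields with box data `v` (`isBloch_cfgA`, `cfgA_repZ`).

## Theorems

1. INJECTIVITY (`fibreLin_injective`): for a multiplicative UNITARY character `χ : AddChar (ℤ^d) ℂ`,
   `‖χ a‖ = 1`, the fibre map is injective — `blochFibre_uniqueness` read on box coordinates (the EL
   residual is itself `χ`-Bloch, so vanishing on the box is vanishing everywhere, `isBloch_eq_zero_of_box`;
   `solves_of_fibreLin_eq`).  Hence bijective, `IsUnit (fibreMatrix χ)`, `(fibreMatrix χ).det ≠ 0`; in
   particular for the Bloch characters `blochChar p : a ↦ exp (i p·a)`, `p ∈ ℝ^d`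
   (`det_fibreMatrix_blochChar_ne_zero`, `mulVec_fibreMatrix_blochChar_injective`).
2. LOCALITY and the BLOCK OPERATOR: all stencils have reach ≤ 3 blocks, so `cfgFun U` only reads `U` on
   `stencil d = [−3, 3]^d ∩ ℤ^d` (`cfgFun_congr`), whence, with `pieceMatrix q := fibreMatrix (δ_q)`,
   `cfgFun U = Σ_{q ∈ stencil d} (pieceMatrix q) (U q)` (`cfgFun_eq_sum`) — a finite-range block-Toeplitz
   operator; by translation covariance (§8) its value on block `y` is `Σ_a (pieceMatrix a) (U (y + a))`
   (`cfgFun_shiftCfg_eq_sum`, the convention `(𝕃U)(y) = Σ_{a ∈ S} L_a U(y + a)` of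
   `FibreInverseDecay.fundamental_left`), and the rows at block `y` are the EL / G / M / Q residuals there
   (`cfgFun_shiftCfg_inl`, `_inr_inl`, `_inr_inr`).
3. SYMBOL FORM: `fibreMatrix c = Σ_{q ∈ stencil d} c q • pieceMatrix q` (`fibreMatrix_eq_sum`); for the
   Bloch characters `fibreMatrix (blochChar p) = Σ_q cexp (I · Σ_μ p_μ q_μ) • pieceMatrix q`
   (`fibreMatrix_blochChar`), which in dimension `d + 1` IS
   `FibreInverseDecay.trigPolySymbol (stencil (d+1)) pieceMatrix p` (`fibreMatrix_blochChar_eq_trigPolySymbol`,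
   by `rfl`) — non-singular at every real momentum (`det_trigPolySymbol_ne_zero`).
4. JUNCTION with `Beta/FibreInverseDecay` (lit2-g10, p182935): the inverse kernel
   `K = FibreInverseDecay.invKernel (stencil (d+1)) pieceMatrix` decays exponentially
   (`invKernel_fibre_decay`, `invKernel_fibre_decay_l1`), satisfies `Σ_a L_a K(x + a) = δ_{x,0} 1`
   (`fibre_fundamental_left`), and the FUNDAMENTAL CONFIGURATION `fundCfg e = (q ↦ K(q) e)` solves the block
   system with the delta source `e` at block `0` (`cfgFun_fundCfg`); read back on `ℤ^{d+1}` for a source on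
   the Q rows: EL everywhere, block-constant gauge quantity, block-mean-free `μ`, block averages
   `contourSum N A κ y = δ_{y,0} e κ` (`fundCfg_solves`) — the columns from which (D4)(iii) assembles the
   `AffineReproduction.InfiniteVolumeSpec` instance.

Nothing here is specific to `d + 1 = 4`; nothing uses or mentions a printed theorem.  The identification of
this typed system with the `U = 1` linearisation of Bałaban's gauge-fixed block-spin problem is the
cell's READING recorded in `HOME/BETA/AN2.md` (Y15)(b)/(Y18), not a fact used here.

Version v1 (2026-08-19, b2b-balaban-beta-an2-g5).  value = kernel bookkeeping leaf, NOT summit progress.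
-/

noncomputable section

namespace Literature.MathematicalPhysics.QuantumFieldTheory.Balaban1983to89.Beta.BlochFibreMatrix

open Complex
open Literature.Probability.LatticeModels (TorusSite Torus.proj Torus.proj_apply)
open AffineAveraging (Site Form0 Form1 Form2 unitVec unitVec_apply dz curv curvAdj codiff₁ box toSite blockSum
  contourSum)
open LatticeForm (IsBloch repZ proj_repZ proj_add_zsmul quo)
open BlochFibreUniqueness (adjContourSum adjContourSum_apply quo_repZ quo_add_zsmul isBloch_iff isBloch_one_iff'
  isBloch_add isBloch_sub isBloch_sum isBloch_bd isBloch_dz isBloch_codiff₁ isBloch_curv isBloch_lapN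
  isBloch_adjContourSum isBloch_contourSum isBloch_blockSum isBloch_eq_zero_of_box curvAdj_eq_bd
  blochFibre_uniqueness)

variable {d N : ℕ}

/-! ## §1 Linearity of the lattice operators (over `ℂ`) -/

section Linearity

/-- `dz` is additive. [folklore] -/
theorem dz_add' (f g : Form0 d ℂ) : dz (f + g) = dz f + dz g := by
  funext κ x; simp only [dz, Pi.add_apply]; ring

/-- `dz` is homogeneous. [folklore] -/
theorem dz_smul' (a : ℂ) (f : Form0 d ℂ) : dz (a • f) = a • dz f := by
  funext κ x; simp only [dz, Pi.smul_apply, smul_eq_mul]; ring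

/-- `curv` is additive. [folklore] -/
theorem curv_add' (A B : Form1 d ℂ) : curv (A + B) = curv A + curv B := by
  funext κ l x; simp only [curv, Pi.add_apply]; ring

/-- `curv` is homogeneous. [folklore] -/
theorem curv_smul' (a : ℂ) (A : Form1 d ℂ) : curv (a • A) = a • curv A := by
  funext κ l x; simp only [curv, Pi.smul_apply, smul_eq_mul]; ring

/-- `curvAdj` is additive. [folklore] -/
theorem curvAdj_add' (F G : Form2 d ℂ) : curvAdj (F + G) = curvAdj F + curvAdj G := by
  funext μ y
  simp only [curvAdj, Pi.add_apply, Finset.sum_add_distrib, Finset.sum_sub_distrib]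
  ring

/-- `curvAdj` is homogeneous. [folklore] -/
theorem curvAdj_smul' (a : ℂ) (F : Form2 d ℂ) : curvAdj (a • F) = a • curvAdj F := by
  funext μ y
  simp only [curvAdj, Pi.smul_apply, smul_eq_mul]
  rw [mul_add, Finset.mul_sum, Finset.mul_sum]
  congr 1 <;> exact Finset.sum_congr rfl (fun _ _ => by ring)

/-- `codiff₁` is additive. [folklore] -/
theorem codiff₁_add' (A B : Form1 d ℂ) : codiff₁ (A + B) = codiff₁ A + codiff₁ B := by
  funext x
  simp only [codiff₁, Pi.add_apply, Finset.sum_add_distrib, Finset.sum_sub_distrib]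
  ring

/-- `codiff₁` is homogeneous. [folklore] -/
theorem codiff₁_smul' (a : ℂ) (A : Form1 d ℂ) : codiff₁ (a • A) = a • codiff₁ A := by
  funext x
  simp only [codiff₁, Pi.smul_apply, smul_eq_mul]
  rw [Finset.mul_sum]
  exact Finset.sum_congr rfl (fun _ _ => by ring)

/-- `adjContourSum` is additive. [folklore] -/
theorem adjContourSum_add' (φ ψ : Form1 d ℂ) : adjContourSum N (φ + ψ) = adjContourSum N φ + adjContourSum N ψ := by
  funext κ x
  simp only [adjContourSum_apply, Pi.add_apply, Finset.sum_add_distrib]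

/-- `adjContourSum` is homogeneous. [folklore] -/
theorem adjContourSum_smul' (a : ℂ) (φ : Form1 d ℂ) : adjContourSum N (a • φ) = a • adjContourSum N φ := by
  funext κ x
  simp only [adjContourSum_apply, Pi.smul_apply, smul_eq_mul, Finset.mul_sum]

/-- `contourSum` is additive. [folklore] -/
theorem contourSum_add' (A B : Form1 d ℂ) : contourSum N (A + B) = contourSum N A + contourSum N B := by
  funext κ y
  simp only [contourSum, Pi.add_apply, Finset.sum_add_distrib]

/-- `contourSum` is homogeneous. [folklore] -/
theorem contourSum_smul' (a : ℂ) (A : Form1 d ℂ) : contourSum N (a • A) = a • contourSum N A := by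
  funext κ y
  simp only [contourSum, Pi.smul_apply, smul_eq_mul, Finset.mul_sum]

/-- `blockSum` is additive. [folklore] -/
theorem blockSum_add' (f g : Form0 d ℂ) : blockSum N (f + g) = blockSum N f + blockSum N g := by
  funext y
  simp only [blockSum, Pi.add_apply, Finset.sum_add_distrib]

/-- `blockSum` is homogeneous. [folklore] -/
theorem blockSum_smul' (a : ℂ) (f : Form0 d ℂ) : blockSum N (a • f) = a • blockSum N f := by
  funext y
  simp only [blockSum, Pi.smul_apply, smul_eq_mul, Finset.mul_sum]

end Linearity

/-! ## §2 The index type, configurations, the residual vector -/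

/-- Box coordinates of the unknowns of one Bloch fibre: `A`-coordinates `(κ, z)`, `μ`-coordinates `z`,
`φ`-coordinates `κ` (value at the coarse origin). [folklore] -/
abbrev Idx (d N : ℕ) : Type := (Fin d × TorusSite d N) ⊕ (TorusSite d N ⊕ Fin d)

/-- A CONFIGURATION: box data attached to every block `q ∈ ℤ^d` of the coarse lattice. [folklore] -/
abbrev Cfg (d N : ℕ) : Type := Site d → Idx d N → ℂ

/-- The fine 1-form of a configuration: `A κ x = U (quo N x) (κ, proj N x)`. [folklore] -/
def cfgA (U : Cfg d N) : Form1 d ℂ := fun κ x => U (quo N x) (Sum.inl (κ, Torus.proj N x))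

/-- The gauge multiplier of a configuration: `μ x = U (quo N x) (proj N x)`. [folklore] -/
def cfgμ (U : Cfg d N) : Form0 d ℂ := fun x => U (quo N x) (Sum.inr (Sum.inl (Torus.proj N x)))

/-- The (coarse) constraint multiplier of a configuration: `φ κ y = U y κ`. [folklore] -/
def cfgφ (U : Cfg d N) : Form1 d ℂ := fun κ y => U y (Sum.inr (Sum.inr κ))

/-- The TENSOR configuration `c ⊗ v`: block `q` carries `c q · v` (for a multiplicative `χ`, `χ ⊗ v` is the `χ`-Bloch
configuration with box data `v`). [folklore] -/
def tens (c : Site d → ℂ) (v : Idx d N → ℂ) : Cfg d N := fun q i => c q * v i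

/-- The 1-form of a configuration is additive in the configuration. [folklore] -/
theorem cfgA_add (U V : Cfg d N) : cfgA (U + V) = cfgA U + cfgA V := by
  funext κ x; simp only [cfgA, Pi.add_apply]

/-- The 1-form of a configuration is homogeneous in the configuration. [folklore] -/
theorem cfgA_smul (a : ℂ) (U : Cfg d N) : cfgA (a • U) = a • cfgA U := by
  funext κ x; simp only [cfgA, Pi.smul_apply]

/-- The gauge multiplier is additive in the configuration. [folklore] -/
theorem cfgμ_add (U V : Cfg d N) : cfgμ (U + V) = cfgμ U + cfgμ V := by
  funext x; simp only [cfgμ, Pi.add_apply]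

/-- The gauge multiplier is homogeneous in the configuration. [folklore] -/
theorem cfgμ_smul (a : ℂ) (U : Cfg d N) : cfgμ (a • U) = a • cfgμ U := by
  funext x; simp only [cfgμ, Pi.smul_apply]

/-- The constraint multiplier is additive in the configuration. [folklore] -/
theorem cfgφ_add (U V : Cfg d N) : cfgφ (U + V) = cfgφ U + cfgφ V := by
  funext κ y; simp only [cfgφ, Pi.add_apply]

/-- The constraint multiplier is homogeneous in the configuration. [folklore] -/
theorem cfgφ_smul (a : ℂ) (U : Cfg d N) : cfgφ (a • U) = a • cfgφ U := by
  funext κ y; simp only [cfgφ, Pi.smul_apply]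

/-- `c ⊗ (v + w) = c ⊗ v + c ⊗ w`. [folklore] -/
theorem tens_add_right (c : Site d → ℂ) (v w : Idx d N → ℂ) : tens c (v + w) = tens c v + tens c w := by
  funext q i; simp only [tens, Pi.add_apply]; ring

/-- `c ⊗ (a • v) = a • (c ⊗ v)`. [folklore] -/
theorem tens_smul_right (c : Site d → ℂ) (a : ℂ) (v : Idx d N → ℂ) : tens c (a • v) = a • tens c v := by
  funext q i; simp only [tens, Pi.smul_apply, smul_eq_mul]; ring

/-- `(a • c) ⊗ v = a • (c ⊗ v)`. [folklore] -/
theorem tens_smul_left (a : ℂ) (c : Site d → ℂ) (v : Idx d N → ℂ) : tens (a • c) v = a • tens c v := by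
  funext q i; simp only [tens, Pi.smul_apply, smul_eq_mul]; ring

/-- THE RESIDUAL VECTOR of the homogeneous gauge-fixed block-averaged KKT system, read on the box of the
origin: EL rows, G rows (`z ≠ 0`), the M row (`z = 0`), Q rows. [folklore] -/
def resid [NeZero N] (A φ : Form1 d ℂ) (μ : Form0 d ℂ) : Idx d N → ℂ := fun i =>
  match i with
  | Sum.inl (κ, z) =>
      curvAdj (curv A) κ (repZ z) - adjContourSum N φ κ (repZ z) - dz (codiff₁ (dz μ)) κ (repZ z)
  | Sum.inr (Sum.inl z) =>
      if z = 0 then blockSum N μ 0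
      else codiff₁ (dz (codiff₁ A)) (repZ z) - codiff₁ (dz (codiff₁ A)) 0
  | Sum.inr (Sum.inr κ) => contourSum N A κ 0

section Resid

variable [NeZero N]

/-- EL rows of the residual. [folklore] -/
@[simp] theorem resid_inl (A φ : Form1 d ℂ) (μ : Form0 d ℂ) (κ : Fin d) (z : TorusSite d N) :
    resid A φ μ (Sum.inl (κ, z))
      = curvAdj (curv A) κ (repZ z) - adjContourSum N φ κ (repZ z) - dz (codiff₁ (dz μ)) κ (repZ z) := rfl

/-- G / M rows of the residual. [folklore] -/
@[simp] theorem resid_inr_inl (A φ : Form1 d ℂ) (μ : Form0 d ℂ) (z : TorusSite d N) :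
    resid A φ μ (Sum.inr (Sum.inl z))
      = if z = 0 then blockSum N μ 0 else codiff₁ (dz (codiff₁ A)) (repZ z) - codiff₁ (dz (codiff₁ A)) 0 := rfl

/-- Q rows of the residual. [folklore] -/
@[simp] theorem resid_inr_inr (A φ : Form1 d ℂ) (μ : Form0 d ℂ) (κ : Fin d) :
    resid (N := N) A φ μ (Sum.inr (Sum.inr κ)) = contourSum N A κ 0 := rfl

/-- The residual is additive in the field triple. [folklore] -/
theorem resid_add (A A' φ φ' : Form1 d ℂ) (μ μ' : Form0 d ℂ) :
    resid (N := N) (A + A') (φ + φ') (μ + μ') = resid A φ μ + resid A' φ' μ' := by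
  funext i
  rcases i with ⟨κ, z⟩ | (z | κ)
  · simp only [Pi.add_apply, resid_inl, curv_add', curvAdj_add', adjContourSum_add', dz_add', codiff₁_add']
    ring
  · simp only [Pi.add_apply, resid_inr_inl, blockSum_add', codiff₁_add', dz_add']
    split_ifs <;> ring
  · simp only [Pi.add_apply, resid_inr_inr, contourSum_add']

/-- The residual is homogeneous in the field triple. [folklore] -/
theorem resid_smul (a : ℂ) (A φ : Form1 d ℂ) (μ : Form0 d ℂ) :
    resid (N := N) (a • A) (a • φ) (a • μ) = a • resid A φ μ := by
  funext i
  rcases i with ⟨κ, z⟩ | (z | κ)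
  · simp only [Pi.smul_apply, smul_eq_mul, resid_inl, curv_smul', curvAdj_smul', adjContourSum_smul', dz_smul',
      codiff₁_smul']
    ring
  · simp only [Pi.smul_apply, smul_eq_mul, resid_inr_inl, blockSum_smul', codiff₁_smul', dz_smul']
    split_ifs <;> ring
  · simp only [Pi.smul_apply, smul_eq_mul, resid_inr_inr, contourSum_smul']

/-- THE RESIDUAL OF A CONFIGURATION on the box of the origin. [folklore] -/
def cfgFun (U : Cfg d N) : Idx d N → ℂ := resid (cfgA U) (cfgφ U) (cfgμ U)

/-- The residual is additive in the configuration. [folklore] -/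
theorem cfgFun_add (U V : Cfg d N) : cfgFun (U + V) = cfgFun U + cfgFun V := by
  simp only [cfgFun, cfgA_add, cfgφ_add, cfgμ_add, resid_add]

/-- The residual is homogeneous in the configuration. [folklore] -/
theorem cfgFun_smul (a : ℂ) (U : Cfg d N) : cfgFun (a • U) = a • cfgFun U := by
  simp only [cfgFun, cfgA_smul, cfgφ_smul, cfgμ_smul, resid_smul]

/-- The residual of the zero configuration vanishes. [folklore] -/
theorem cfgFun_zero : cfgFun (0 : Cfg d N) = 0 := by
  have h := cfgFun_smul (N := N) (d := d) (0 : ℂ) 0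
  rwa [zero_smul, zero_smul] at h

/-- The residual of a finite sum of configurations. [folklore] -/
theorem cfgFun_finset_sum {ι : Type*} (s : Finset ι) (W : ι → Cfg d N) :
    cfgFun (∑ i ∈ s, W i) = ∑ i ∈ s, cfgFun (W i) := by
  classical
  induction s using Finset.induction_on with
  | empty => simp only [Finset.sum_empty]; exact cfgFun_zero
  | insert j s hj ih => rw [Finset.sum_insert hj, Finset.sum_insert hj, cfgFun_add, ih]

end Resid

/-! ## §3 The fibre map and its matrix -/

section Fibre

variable [NeZero N]

/-- The fibre map on box coordinates: `v ↦` the residual vector of the tensor configuration `c ⊗ v`. [folklore] -/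
def fibreFun (c : Site d → ℂ) (v : Idx d N → ℂ) : Idx d N → ℂ := cfgFun (tens c v)

/-- The fibre map is additive in the box data. [folklore] -/
theorem fibreFun_add_v (c : Site d → ℂ) (v w : Idx d N → ℂ) : fibreFun c (v + w) = fibreFun c v + fibreFun c w := by
  simp only [fibreFun, tens_add_right, cfgFun_add]

/-- The fibre map is homogeneous in the box data. [folklore] -/
theorem fibreFun_smul_v (c : Site d → ℂ) (a : ℂ) (v : Idx d N → ℂ) : fibreFun c (a • v) = a • fibreFun c v := by
  simp only [fibreFun, tens_smul_right, cfgFun_smul]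

/-- The fibre map is homogeneous in the coefficient function. [folklore] -/
theorem fibreFun_smul_c (a : ℂ) (c : Site d → ℂ) (v : Idx d N → ℂ) : fibreFun (a • c) v = a • fibreFun c v := by
  simp only [fibreFun, tens_smul_left, cfgFun_smul]

/-- THE FIBRE MAP as a linear endomorphism of the box-coordinate space. [folklore] -/
def fibreLin (c : Site d → ℂ) : (Idx d N → ℂ) →ₗ[ℂ] (Idx d N → ℂ) where
  toFun := fibreFun c
  map_add' := fibreFun_add_v c
  map_smul' a v := by simp only [RingHom.id_apply]; exact fibreFun_smul_v c a v

/-- Unfolding the fibre map. [folklore] -/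
@[simp] theorem fibreLin_apply (c : Site d → ℂ) (v : Idx d N → ℂ) : fibreLin c v = fibreFun c v := rfl

/-- THE FIBRE MATRIX (square by construction: same index type for unknowns and equations). [folklore] -/
def fibreMatrix (c : Site d → ℂ) : Matrix (Idx d N) (Idx d N) ℂ := LinearMap.toMatrix' (fibreLin c)

/-- `fibreMatrix c` acts as the fibre map. [folklore] -/
theorem fibreMatrix_mulVec (c : Site d → ℂ) (v : Idx d N → ℂ) : (fibreMatrix c).mulVec v = fibreFun c v := by
  rw [fibreMatrix, LinearMap.toMatrix'_mulVec, fibreLin_apply]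

end Fibre

/-! ## §4 Multiplicative characters: the tensor configuration is Bloch with box data `v`; INJECTIVITY -/

section Character

variable [NeZero N] (χ : AddChar (Site d) ℂ)

omit [NeZero N] in
/-- `repZ 0 = 0`. [folklore] -/
theorem repZ_zero : repZ (0 : TorusSite d N) = 0 := by
  funext j; simp [repZ]

/-- For a multiplicative `χ`, the 1-form of `χ ⊗ v` is `χ`-Bloch w.r.t. `N•ℤ^d`. [folklore] -/
theorem isBloch_cfgA (v : Idx d N → ℂ) (κ : Fin d) : IsBloch N (⇑χ) (cfgA (tens (⇑χ) v) κ) := by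
  rw [isBloch_iff]; intro x a
  simp only [cfgA, tens, quo_add_zsmul, proj_add_zsmul, AddChar.map_add_eq_mul]; ring

/-- For a multiplicative `χ`, the gauge multiplier of `χ ⊗ v` is `χ`-Bloch w.r.t. `N•ℤ^d`. [folklore] -/
theorem isBloch_cfgμ (v : Idx d N → ℂ) : IsBloch N (⇑χ) (cfgμ (tens (⇑χ) v)) := by
  rw [isBloch_iff]; intro x a
  simp only [cfgμ, tens, quo_add_zsmul, proj_add_zsmul, AddChar.map_add_eq_mul]; ring

omit [NeZero N] in
/-- For a multiplicative `χ`, the constraint multiplier of `χ ⊗ v` is `χ`-Bloch w.r.t. `ℤ^d`. [folklore] -/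
theorem isBloch_cfgφ (v : Idx d N → ℂ) (κ : Fin d) : IsBloch 1 (⇑χ) (cfgφ (tens (⇑χ) v) κ) := by
  rw [isBloch_one_iff']; intro y a
  simp only [cfgφ, tens, AddChar.map_add_eq_mul]; ring

/-- Box values of the 1-form of `χ ⊗ v`. [folklore] -/
theorem cfgA_repZ (v : Idx d N → ℂ) (κ : Fin d) (z : TorusSite d N) :
    cfgA (tens (⇑χ) v) κ (repZ z) = v (Sum.inl (κ, z)) := by
  simp only [cfgA, tens, quo_repZ, proj_repZ, AddChar.map_zero_eq_one, one_mul]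

/-- Box values of the gauge multiplier of `χ ⊗ v`. [folklore] -/
theorem cfgμ_repZ (v : Idx d N → ℂ) (z : TorusSite d N) :
    cfgμ (tens (⇑χ) v) (repZ z) = v (Sum.inr (Sum.inl z)) := by
  simp only [cfgμ, tens, quo_repZ, proj_repZ, AddChar.map_zero_eq_one, one_mul]

omit [NeZero N] in
/-- Value of the constraint multiplier of `χ ⊗ v` at the coarse origin. [folklore] -/
theorem cfgφ_zero (v : Idx d N → ℂ) (κ : Fin d) : cfgφ (tens (⇑χ) v) κ 0 = v (Sum.inr (Sum.inr κ)) := by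
  simp only [cfgφ, tens, AddChar.map_zero_eq_one, one_mul]

omit [NeZero N] in
/-- `curvAdj` preserves `χ`-Bloch fields (componentwise). [folklore] -/
theorem isBloch_curvAdj {χ' : Site d → ℂ} {F : Form2 d ℂ} (hF : ∀ κ l, IsBloch N χ' (F κ l)) (μ : Fin d) :
    IsBloch N χ' (curvAdj F μ) := by
  rw [curvAdj_eq_bd]
  exact isBloch_sub (isBloch_sum _ (fun κ _ => isBloch_bd (hF κ μ) κ)) (isBloch_sum _ (fun l _ => isBloch_bd (hF μ l) l))

omit [NeZero N] in
/-- From a box offset to a torus point with the same representative. [folklore] -/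
theorem toSite_eq_repZ_proj {b : Fin d → ℕ} (hb : b ∈ box d N) : toSite b = repZ (Torus.proj N (toSite b)) := by
  funext j
  have hbj : b j < N := Finset.mem_range.1 (Fintype.mem_piFinset.1 hb j)
  simp only [repZ, Torus.proj_apply, toSite]
  rw [Int.cast_natCast, ZMod.val_natCast, Nat.mod_eq_of_lt hbj]

/-- THE SYSTEM READ BACK ON `ℤ^d`.  If `fibreLin χ v = rhs` with `rhs` vanishing on the EL, G and M rows, then the
`χ`-Bloch fields of `χ ⊗ v` satisfy the Euler–Lagrange equation EVERYWHERE, the gauge quantity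
`codiff₁ (dz (codiff₁ A))` is constant on EVERY block, every block sum of `μ` vanishes, and the block averages are
`contourSum N A κ y = χ y · rhs (Q row κ)`. [folklore] -/
theorem solves_of_fibreLin_eq {v rhs : Idx d N → ℂ} (h : fibreLin (⇑χ) v = rhs)
    (hEL0 : ∀ κ z, rhs (Sum.inl (κ, z)) = 0) (hGM0 : ∀ z, rhs (Sum.inr (Sum.inl z)) = 0) :
    curvAdj (curv (cfgA (tens (⇑χ) v))) = adjContourSum N (cfgφ (tens (⇑χ) v)) + dz (codiff₁ (dz (cfgμ (tens (⇑χ) v))))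
    ∧ (∀ (y : Site d), ∀ b ∈ box d N, codiff₁ (dz (codiff₁ (cfgA (tens (⇑χ) v)))) ((N : ℤ) • y + toSite b)
        = codiff₁ (dz (codiff₁ (cfgA (tens (⇑χ) v)))) ((N : ℤ) • y))
    ∧ (∀ y : Site d, blockSum N (cfgμ (tens (⇑χ) v)) y = 0)
    ∧ (∀ (κ : Fin d) (y : Site d), contourSum N (cfgA (tens (⇑χ) v)) κ y = χ y * rhs (Sum.inr (Sum.inr κ))) := by
  have hres : ∀ i, resid (cfgA (tens (⇑χ) v)) (cfgφ (tens (⇑χ) v)) (cfgμ (tens (⇑χ) v)) i = rhs i := fun i => by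
    have := congrArg (fun f => f i) h
    simpa only [fibreLin_apply, fibreFun, cfgFun] using this
  set A := cfgA (tens (⇑χ) v) with hAdef
  set φ := cfgφ (tens (⇑χ) v) with hφdef
  set μ := cfgμ (tens (⇑χ) v) with hμdef
  have hA : ∀ κ, IsBloch N (⇑χ) (A κ) := isBloch_cfgA χ v
  have hφ : ∀ κ, IsBloch 1 (⇑χ) (φ κ) := isBloch_cfgφ χ v
  have hμ : IsBloch N (⇑χ) μ := isBloch_cfgμ χ v
  -- EL everywhere
  have hEL : curvAdj (curv A) = adjContourSum N φ + dz (codiff₁ (dz μ)) := by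
    funext κ
    have hR : IsBloch N (⇑χ)
        (fun x => curvAdj (curv A) κ x - (adjContourSum N φ κ x + dz (codiff₁ (dz μ)) κ x)) :=
      isBloch_sub (isBloch_curvAdj (fun κ l => isBloch_curv hA κ l) κ)
        (isBloch_add (isBloch_adjContourSum hφ κ) (isBloch_dz (isBloch_lapN hμ) κ))
    have h0 := isBloch_eq_zero_of_box hR (fun z => by
      have := hres (Sum.inl (κ, z))
      rw [resid_inl, hEL0] at this
      linear_combination this)
    funext x
    have := congrArg (fun f => f x) h0
    simp only [Pi.zero_apply] at this
    simp only [Pi.add_apply]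
    exact sub_eq_zero.1 this
  -- gauge quantity block-constant on the block of the origin, then everywhere
  have hΓ : IsBloch N (⇑χ) (codiff₁ (dz (codiff₁ A))) := isBloch_lapN (isBloch_codiff₁ hA)
  have hG0 : ∀ b ∈ box d N, codiff₁ (dz (codiff₁ A)) (toSite b) = codiff₁ (dz (codiff₁ A)) 0 := by
    intro b hb
    rw [toSite_eq_repZ_proj hb]
    by_cases hz : Torus.proj N (toSite b) = 0
    · rw [hz, repZ_zero]
    · have := hres (Sum.inr (Sum.inl (Torus.proj N (toSite b))))
      rw [resid_inr_inl, if_neg hz, hGM0] at this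
      exact sub_eq_zero.1 this
  have hG : ∀ (y : Site d), ∀ b ∈ box d N,
      codiff₁ (dz (codiff₁ A)) ((N : ℤ) • y + toSite b) = codiff₁ (dz (codiff₁ A)) ((N : ℤ) • y) := by
    intro y b hb
    have h1 := (isBloch_iff.1 hΓ) (toSite b) y
    have h2 := (isBloch_iff.1 hΓ) 0 y
    rw [add_comm] at h1
    rw [zero_add] at h2
    rw [h1, h2, hG0 b hb]
  -- block sums of μ
  have hM0 : blockSum N μ 0 = 0 := by
    have := hres (Sum.inr (Sum.inl 0))
    rwa [resid_inr_inl, if_pos rfl, hGM0] at this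
  have hM : ∀ y : Site d, blockSum N μ y = 0 := by
    intro y
    have h1 := (isBloch_one_iff'.1 (isBloch_blockSum hμ)) 0 y
    rw [zero_add, hM0, mul_zero] at h1
    exact h1
  -- block averages
  have hQ : ∀ (κ : Fin d) (y : Site d), contourSum N A κ y = χ y * rhs (Sum.inr (Sum.inr κ)) := by
    intro κ y
    have h1 := (isBloch_one_iff'.1 (isBloch_contourSum hA κ)) 0 y
    rw [zero_add] at h1
    rw [h1, ← hres (Sum.inr (Sum.inr κ)), resid_inr_inr]
  exact ⟨hEL, hG, hM, hQ⟩

/-- **INJECTIVITY OF EVERY UNITARY FIBRE.**  For a multiplicative unitary character `χ` the fibre map is injective: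
a box-coordinate vector in its kernel gives `χ`-Bloch fields solving the homogeneous system of
`blochFibre_uniqueness`, hence vanishing, and the fields determine the vector. [folklore] -/
theorem eq_zero_of_fibreLin_eq_zero (hχ : ∀ a, ‖χ a‖ = 1) {v : Idx d N → ℂ} (h : fibreLin (⇑χ) v = 0) : v = 0 := by
  obtain ⟨hEL, hG, hM, hQ⟩ := solves_of_fibreLin_eq χ (v := v) (rhs := 0) h (fun _ _ => rfl) (fun _ => rfl)
  have hG' : ∀ b ∈ box d N, codiff₁ (dz (codiff₁ (cfgA (tens (⇑χ) v)))) (toSite b)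
      = codiff₁ (dz (codiff₁ (cfgA (tens (⇑χ) v)))) 0 := by
    intro b hb; simpa using hG 0 b hb
  have hQ' : ∀ κ, contourSum N (cfgA (tens (⇑χ) v)) κ 0 = 0 := fun κ => by rw [hQ κ 0]; simp
  obtain ⟨hA0, hφ0, hμ0⟩ := blochFibre_uniqueness hχ (isBloch_cfgA χ v) (isBloch_cfgφ χ v) (isBloch_cfgμ χ v)
    hEL hQ' hG' (hM 0)
  funext i
  rcases i with ⟨κ, z⟩ | (z | κ)
  · rw [← cfgA_repZ χ v κ z, hA0]; rfl
  · rw [← cfgμ_repZ χ v z, hμ0]; rfl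
  · rw [← cfgφ_zero χ v κ, hφ0]; rfl

/-- The fibre map of a unitary character is injective. [folklore] -/
theorem fibreLin_injective (hχ : ∀ a, ‖χ a‖ = 1) : Function.Injective (fibreLin (N := N) (⇑χ)) :=
  (injective_iff_map_eq_zero _).2 fun _ hv => eq_zero_of_fibreLin_eq_zero χ hχ hv

/-- … hence bijective (square system). [folklore] -/
theorem fibreLin_bijective (hχ : ∀ a, ‖χ a‖ = 1) : Function.Bijective (fibreLin (N := N) (⇑χ)) :=
  ⟨fibreLin_injective χ hχ, LinearMap.injective_iff_surjective.1 (fibreLin_injective χ hχ)⟩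

/-- … hence the fibre matrix is invertible. [folklore] -/
theorem isUnit_fibreMatrix (hχ : ∀ a, ‖χ a‖ = 1) : IsUnit (fibreMatrix (N := N) (⇑χ)) := by
  rw [← Matrix.mulVec_injective_iff_isUnit]
  intro v w hvw
  apply fibreLin_injective χ hχ
  simpa only [fibreLin_apply, fibreMatrix_mulVec] using hvw

/-- … and has non-zero determinant. [folklore] -/
theorem det_fibreMatrix_ne_zero (hχ : ∀ a, ‖χ a‖ = 1) : (fibreMatrix (N := N) (⇑χ)).det ≠ 0 :=
  isUnit_iff_ne_zero.1 ((Matrix.isUnit_iff_isUnit_det _).1 (isUnit_fibreMatrix χ hχ))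

end Character

/-! ## §5 Locality: the fibre map reads the coefficients only on the cube `[−3, 3]^d` -/

section Locality

/-- The finite stencil cube `[−3, 3]^d ∩ ℤ^d` of coarse offsets seen from the box of the origin. [folklore] -/
def stencil (d : ℕ) : Finset (Site d) := Fintype.piFinset fun _ : Fin d => Finset.Icc (-3 : ℤ) 3

/-- Membership in the stencil cube. [folklore] -/
theorem mem_stencil {q : Site d} : q ∈ stencil d ↔ ∀ j, -3 ≤ q j ∧ q j ≤ 3 := by
  simp [stencil, Fintype.mem_piFinset, Finset.mem_Icc]

/-- The origin lies in the stencil cube. [folklore] -/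
theorem zero_mem_stencil : (0 : Site d) ∈ stencil d := by
  rw [mem_stencil]; intro j; simp

variable [NeZero N]

/-- Points with coordinates in `[−3N, 4N)` lie in blocks of the stencil cube. [folklore] -/
theorem quo_mem_stencil {x : Site d} (h1 : ∀ j, -(3 * (N : ℤ)) ≤ x j) (h2 : ∀ j, x j < 4 * (N : ℤ)) :
    quo N x ∈ stencil d := by
  have hN : (0 : ℤ) < N := by exact_mod_cast Nat.pos_of_ne_zero (NeZero.ne N)
  rw [mem_stencil]; intro j
  simp only [quo]
  refine ⟨?_, ?_⟩
  · rw [Int.le_ediv_iff_mul_le hN]; linarith [h1 j]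
  · have : x j / (N : ℤ) < 4 := by rw [Int.ediv_lt_iff_lt_mul hN]; linarith [h2 j]
    omega

omit [NeZero N] in
/-- Box representatives are non-negative. [folklore] -/
theorem repZ_nonneg (z : TorusSite d N) (j : Fin d) : 0 ≤ repZ z j := by
  simp only [repZ]; positivity

/-- Box representatives are `< N`. [folklore] -/
theorem repZ_lt (z : TorusSite d N) (j : Fin d) : repZ z j < N := by
  simp only [repZ]; exact_mod_cast ZMod.val_lt (z j)

/-- Box points shifted by at most `3` in each coordinate lie in stencil blocks. [folklore] -/
theorem quo_repZ_add_mem (z : TorusSite d N) {t : Site d} (ht : ∀ j, -3 ≤ t j ∧ t j ≤ 3) :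
    quo N (repZ z + t) ∈ stencil d := by
  have hN1 : (1 : ℤ) ≤ N := by exact_mod_cast Nat.one_le_iff_ne_zero.mpr (NeZero.ne N)
  apply quo_mem_stencil
  · intro j; have := repZ_nonneg z j; have := (ht j).1; simp only [Pi.add_apply]; linarith
  · intro j; have := repZ_lt z j; have := (ht j).2; simp only [Pi.add_apply]; linarith

/-- Agreement of two scalar fields on the cube of radius `r` around `x`. [folklore] -/
def Agree (r : ℕ) (f g : Form0 d ℂ) (x : Site d) : Prop :=
  ∀ t : Site d, (∀ j, -(r : ℤ) ≤ t j ∧ t j ≤ r) → f (x + t) = g (x + t)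

/-- Agreement at the centre. [folklore] -/
theorem Agree.self {r : ℕ} {f g : Form0 d ℂ} {x : Site d} (h : Agree r f g x) : f x = g x := by
  have := h 0 (fun j => by simp)
  simpa using this

/-- Agreement on a smaller cube. [folklore] -/
theorem Agree.mono {r : ℕ} {f g : Form0 d ℂ} {x : Site d} (h : Agree (r + 1) f g x) : Agree r f g x := by
  intro t ht
  exact h t (fun j => by have := ht j; push_cast; omega)

/-- Agreement around the forward neighbour, radius one less. [folklore] -/
theorem Agree.add_unitVec {r : ℕ} {f g : Form0 d ℂ} {x : Site d} (h : Agree (r + 1) f g x) (κ : Fin d) :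
    Agree r f g (x + unitVec κ) := by
  intro t ht
  have hb : ∀ j, -((r + 1 : ℕ) : ℤ) ≤ (t + unitVec κ) j ∧ (t + unitVec κ) j ≤ ((r + 1 : ℕ) : ℤ) := by
    intro j
    have := ht j
    simp only [Pi.add_apply, unitVec_apply]
    split_ifs <;> push_cast <;> omega
  have := h (t + unitVec κ) hb
  rwa [show x + (t + unitVec κ) = x + unitVec κ + t by abel] at this

/-- Agreement around the backward neighbour, radius one less. [folklore] -/
theorem Agree.sub_unitVec {r : ℕ} {f g : Form0 d ℂ} {x : Site d} (h : Agree (r + 1) f g x) (κ : Fin d) :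
    Agree r f g (x - unitVec κ) := by
  intro t ht
  have hb : ∀ j, -((r + 1 : ℕ) : ℤ) ≤ (t - unitVec κ) j ∧ (t - unitVec κ) j ≤ ((r + 1 : ℕ) : ℤ) := by
    intro j
    have := ht j
    simp only [Pi.sub_apply, unitVec_apply]
    split_ifs <;> push_cast <;> omega
  have := h (t - unitVec κ) hb
  rwa [show x + (t - unitVec κ) = x - unitVec κ + t by abel] at this

/-- `dz` lowers the agreement radius by one. [folklore] -/
theorem agree_dz {r : ℕ} {f g : Form0 d ℂ} {x : Site d} (h : Agree (r + 1) f g x) (κ : Fin d) :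
    Agree r (dz f κ) (dz g κ) x := by
  intro t ht
  simp only [dz]
  rw [show x + t + unitVec κ = x + unitVec κ + t by abel, (h.add_unitVec κ) t ht, h.mono t ht]

/-- `codiff₁` lowers the agreement radius by one. [folklore] -/
theorem agree_codiff₁ {r : ℕ} {A B : Form1 d ℂ} {x : Site d} (h : ∀ l, Agree (r + 1) (A l) (B l) x) :
    Agree r (codiff₁ A) (codiff₁ B) x := by
  intro t ht
  simp only [codiff₁]
  refine Finset.sum_congr rfl (fun l _ => ?_)
  rw [show x + t - unitVec l = x - unitVec l + t by abel, ((h l).sub_unitVec l) t ht, (h l).mono t ht]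

/-- `curv` lowers the agreement radius by one. [folklore] -/
theorem agree_curv {r : ℕ} {A B : Form1 d ℂ} {x : Site d} (h : ∀ l, Agree (r + 1) (A l) (B l) x) (κ l : Fin d) :
    Agree r (curv A κ l) (curv B κ l) x := by
  intro t ht
  simp only [curv]
  rw [show x + t + unitVec κ = x + unitVec κ + t by abel, show x + t + unitVec l = x + unitVec l + t by abel,
    (h κ).mono t ht, (h l).mono t ht, ((h l).add_unitVec κ) t ht, ((h κ).add_unitVec l) t ht]

/-- `curvAdj` lowers the agreement radius by one. [folklore] -/
theorem agree_curvAdj {r : ℕ} {F G : Form2 d ℂ} {x : Site d} (h : ∀ κ l, Agree (r + 1) (F κ l) (G κ l) x)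
    (μ : Fin d) : Agree r (curvAdj F μ) (curvAdj G μ) x := by
  intro t ht
  simp only [curvAdj]
  congr 1
  · refine Finset.sum_congr rfl (fun l _ => ?_)
    rw [show x + t - unitVec l = x - unitVec l + t by abel, (h μ l).mono t ht, ((h μ l).sub_unitVec l) t ht]
  · refine Finset.sum_congr rfl (fun κ _ => ?_)
    rw [show x + t - unitVec κ = x - unitVec κ + t by abel, (h κ μ).mono t ht, ((h κ μ).sub_unitVec κ) t ht]

variable {U U' : Cfg d N}

/-- Configurations agreeing on the stencil cube give `A`-fields agreeing on radius-3 cubes around box points. [folklore] -/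
theorem agree_cfgA (h : ∀ q ∈ stencil d, U q = U' q) (κ : Fin d) (z : TorusSite d N) :
    Agree 3 (cfgA U κ) (cfgA U' κ) (repZ z) := by
  intro t ht
  simp only [cfgA]
  rw [h _ (quo_repZ_add_mem z (fun j => by have := ht j; push_cast at this; exact this))]

/-- Same for the `μ`-fields. [folklore] -/
theorem agree_cfgμ (h : ∀ q ∈ stencil d, U q = U' q) (z : TorusSite d N) :
    Agree 3 (cfgμ U) (cfgμ U') (repZ z) := by
  intro t ht
  simp only [cfgμ]
  rw [h _ (quo_repZ_add_mem z (fun j => by have := ht j; push_cast at this; exact this))]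

/-- EL entry, curvature part. [folklore] -/
theorem curvAdj_curv_congr (h : ∀ q ∈ stencil d, U q = U' q) (κ : Fin d) (z : TorusSite d N) :
    curvAdj (curv (cfgA U)) κ (repZ z) = curvAdj (curv (cfgA U')) κ (repZ z) := by
  have h3 : ∀ l, Agree (1 + 1 + 1) (cfgA U l) (cfgA U' l) (repZ z) := fun l => agree_cfgA h l z
  have h2 : ∀ k l, Agree (1 + 1) (curv (cfgA U) k l) (curv (cfgA U') k l) (repZ z) :=
    fun k l => agree_curv h3 k l
  exact ((agree_curvAdj h2 κ).mono).self

/-- EL entry, gauge-multiplier part. [folklore] -/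
theorem dz_lap_congr (h : ∀ q ∈ stencil d, U q = U' q) (κ : Fin d) (z : TorusSite d N) :
    dz (codiff₁ (dz (cfgμ U))) κ (repZ z) = dz (codiff₁ (dz (cfgμ U'))) κ (repZ z) := by
  have h3 : Agree (0 + 1 + 1 + 1) (cfgμ U) (cfgμ U') (repZ z) := agree_cfgμ h z
  have h2 : ∀ l, Agree (0 + 1 + 1) (dz (cfgμ U) l) (dz (cfgμ U') l) (repZ z) := fun l => agree_dz h3 l
  have h1 : Agree (0 + 1) (codiff₁ (dz (cfgμ U))) (codiff₁ (dz (cfgμ U'))) (repZ z) := agree_codiff₁ h2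
  exact (agree_dz h1 κ).self

/-- G entries. [folklore] -/
theorem gaugeObs_congr (h : ∀ q ∈ stencil d, U q = U' q) (z : TorusSite d N) :
    codiff₁ (dz (codiff₁ (cfgA U))) (repZ z) = codiff₁ (dz (codiff₁ (cfgA U'))) (repZ z) := by
  have h3 : ∀ l, Agree (0 + 1 + 1 + 1) (cfgA U l) (cfgA U' l) (repZ z) := fun l => agree_cfgA h l z
  have h2 : Agree (0 + 1 + 1) (codiff₁ (cfgA U)) (codiff₁ (cfgA U')) (repZ z) := agree_codiff₁ h3
  have h1 : ∀ l, Agree (0 + 1) (dz (codiff₁ (cfgA U)) l) (dz (codiff₁ (cfgA U')) l) (repZ z) :=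
    fun l => agree_dz h2 l
  exact (agree_codiff₁ h1).self

/-- EL entry, constraint-multiplier part. [folklore] -/
theorem adjContourSum_congr (h : ∀ q ∈ stencil d, U q = U' q) (κ : Fin d) (z : TorusSite d N) :
    adjContourSum N (cfgφ U) κ (repZ z) = adjContourSum N (cfgφ U') κ (repZ z) := by
  have hN : (0 : ℤ) < N := by exact_mod_cast Nat.pos_of_ne_zero (NeZero.ne N)
  rw [adjContourSum_apply, adjContourSum_apply]
  refine Finset.sum_congr rfl (fun s hs => ?_)
  have hs' : (s : ℤ) < N := by exact_mod_cast Finset.mem_range.1 hs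
  simp only [cfgφ]
  rw [h _ (quo_mem_stencil ?_ ?_)]
  · intro j
    have := repZ_nonneg z j
    simp only [Pi.sub_apply, Pi.smul_apply, unitVec_apply, smul_eq_mul]
    split_ifs <;> nlinarith [hN]
  · intro j
    have := repZ_lt z j
    simp only [Pi.sub_apply, Pi.smul_apply, unitVec_apply, smul_eq_mul]
    split_ifs <;> nlinarith [hN, (Int.natCast_nonneg s : (0 : ℤ) ≤ s)]

/-- M entry. [folklore] -/
theorem blockSum_congr (h : ∀ q ∈ stencil d, U q = U' q) :
    blockSum N (cfgμ U) 0 = blockSum N (cfgμ U') 0 := by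
  have hN : (0 : ℤ) < N := by exact_mod_cast Nat.pos_of_ne_zero (NeZero.ne N)
  simp only [blockSum, smul_zero, zero_add]
  refine Finset.sum_congr rfl (fun b hb => ?_)
  simp only [cfgμ]
  rw [h _ (quo_mem_stencil ?_ ?_)]
  · intro j
    simp only [toSite]
    have h0 : (0 : ℤ) ≤ (b j : ℤ) := Int.natCast_nonneg _
    linarith [hN]
  · intro j
    have hbj : b j < N := Finset.mem_range.1 (Fintype.mem_piFinset.1 hb j)
    simp only [toSite]
    have : ((b j : ℕ) : ℤ) < N := by exact_mod_cast hbj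
    linarith [hN]

/-- Q entry. [folklore] -/
theorem contourSum_congr (h : ∀ q ∈ stencil d, U q = U' q) (κ : Fin d) :
    contourSum N (cfgA U) κ 0 = contourSum N (cfgA U') κ 0 := by
  have hN : (0 : ℤ) < N := by exact_mod_cast Nat.pos_of_ne_zero (NeZero.ne N)
  simp only [contourSum, smul_zero, zero_add]
  refine Finset.sum_congr rfl (fun b hb => Finset.sum_congr rfl (fun s hs => ?_))
  have hs' : (s : ℤ) < N := by exact_mod_cast Finset.mem_range.1 hs
  have hbj : ∀ j, ((b j : ℕ) : ℤ) < N := fun j => by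
    exact_mod_cast Finset.mem_range.1 (Fintype.mem_piFinset.1 hb j)
  simp only [cfgA]
  rw [h _ (quo_mem_stencil ?_ ?_)]
  · intro j
    simp only [Pi.add_apply, Pi.smul_apply, toSite, unitVec_apply, smul_eq_mul]
    split_ifs <;> nlinarith [hN, (Int.natCast_nonneg s : (0 : ℤ) ≤ s),
      (Int.natCast_nonneg (b j) : (0 : ℤ) ≤ b j)]
  · intro j
    have := hbj j
    simp only [Pi.add_apply, Pi.smul_apply, toSite, unitVec_apply, smul_eq_mul]
    split_ifs <;> nlinarith [hN, (Int.natCast_nonneg s : (0 : ℤ) ≤ s),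
      (Int.natCast_nonneg (b j) : (0 : ℤ) ≤ b j)]

/-- **LOCALITY.**  The residual on the box of the origin only reads the configuration on the stencil cube. [folklore] -/
theorem cfgFun_congr (h : ∀ q ∈ stencil d, U q = U' q) : cfgFun U = cfgFun U' := by
  funext i
  rcases i with ⟨κ, z⟩ | (z | κ)
  · simp only [cfgFun, resid_inl]
    rw [curvAdj_curv_congr h, dz_lap_congr h, adjContourSum_congr h]
  · simp only [cfgFun, resid_inr_inl]
    split_ifs
    · exact blockSum_congr h
    · rw [gaugeObs_congr h z, ← repZ_zero (N := N), gaugeObs_congr h 0]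
  · simp only [cfgFun, resid_inr_inr]
    exact contourSum_congr h κ

end Locality

/-! ## §6 The block operator: `cfgFun U = Σ_{q ∈ stencil} L_q (U q)` and the symbol form of the fibre matrix -/

section Symbol

variable [NeZero N]

/-- The indicator of one coarse offset. [folklore] -/
def delta (q : Site d) : Site d → ℂ := fun y => if y = q then 1 else 0

/-- The matrix of the one-offset piece `q`: the part of the system that reads the data on block `q`
(and `φ` at the coarse site `q`). [folklore] -/
def pieceMatrix (q : Site d) : Matrix (Idx d N) (Idx d N) ℂ := fibreMatrix (delta q)

omit [NeZero N] in
/-- A configuration agrees on the stencil cube with its stencil part `Σ_{q ∈ stencil} δ_q ⊗ U q`. [folklore] -/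
theorem cfg_eq_sum_tens_on_stencil (U : Cfg d N) :
    ∀ q ∈ stencil d, U q = (∑ a ∈ stencil d, tens (delta a) (U a)) q := by
  intro q hq
  funext i
  rw [Finset.sum_apply, Finset.sum_apply]
  simp only [tens, delta]
  rw [Finset.sum_eq_single_of_mem q hq (fun a _ ha => by rw [if_neg (Ne.symm ha), zero_mul])]
  rw [if_pos rfl, one_mul]

/-- **THE BLOCK OPERATOR.**  The residual of ANY configuration on the box of the origin is
`Σ_{q ∈ [−3,3]^d} L_q (U q)`: the system is a finite-range block-Toeplitz operator with matrix coefficients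
`L_q = pieceMatrix q`. [folklore] -/
theorem cfgFun_eq_sum (U : Cfg d N) : cfgFun U = ∑ q ∈ stencil d, (pieceMatrix q).mulVec (U q) := by
  rw [cfgFun_congr (cfg_eq_sum_tens_on_stencil U), cfgFun_finset_sum]
  refine Finset.sum_congr rfl (fun q _ => ?_)
  show fibreFun (delta q) (U q) = (pieceMatrix q).mulVec (U q)
  rw [pieceMatrix, fibreMatrix_mulVec]

/-- **SYMBOL FORM of the fibre map**: `fibreFun c v = Σ_q c q • L_q v`. [folklore] -/
theorem fibreFun_eq_sum (c : Site d → ℂ) (v : Idx d N → ℂ) :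
    fibreFun c v = ∑ q ∈ stencil d, c q • (pieceMatrix q).mulVec v := by
  rw [fibreFun, cfgFun_eq_sum]
  refine Finset.sum_congr rfl (fun q _ => ?_)
  rw [show tens c v q = c q • v from by funext i; simp [tens, smul_eq_mul], Matrix.mulVec_smul]

/-- **SYMBOL FORM of the fibre matrix**: `𝕃(c) = Σ_{q ∈ [−3,3]^d} c q • L_q`. [folklore] -/
theorem fibreMatrix_eq_sum (c : Site d → ℂ) :
    fibreMatrix (N := N) c = ∑ q ∈ stencil d, c q • pieceMatrix q := by
  apply Matrix.toLin'.injective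
  apply LinearMap.ext; intro v
  rw [Matrix.toLin'_apply, Matrix.toLin'_apply, fibreMatrix_mulVec, fibreFun_eq_sum, Matrix.sum_mulVec]
  refine Finset.sum_congr rfl (fun q _ => ?_)
  rw [Matrix.smul_mulVec]

end Symbol

/-! ## §7 The Bloch characters `χ_p (a) = exp (i p·a)`, `p ∈ ℂ^d`; non-singularity on the real torus -/

section BlochChar

/-- The complex pairing `p·a = Σ_μ p_μ a_μ`. [folklore] -/
def pdot (p : Fin d → ℂ) (a : Site d) : ℂ := ∑ μ, p μ * (a μ : ℂ)

/-- `p·0 = 0`. [folklore] -/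
theorem pdot_zero (p : Fin d → ℂ) : pdot p 0 = 0 := by
  simp [pdot]

/-- `p·(a + b) = p·a + p·b`. [folklore] -/
theorem pdot_add (p : Fin d → ℂ) (a b : Site d) : pdot p (a + b) = pdot p a + pdot p b := by
  simp only [pdot, Pi.add_apply, Int.cast_add, mul_add, Finset.sum_add_distrib]

/-- THE BLOCH CHARACTER of (complex) quasi-momentum `p`: `a ↦ exp (i p·a)`, a multiplicative character of `ℤ^d`.
[folklore] -/
def blochChar (p : Fin d → ℂ) : AddChar (Site d) ℂ where
  toFun a := cexp (I * pdot p a)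
  map_zero_eq_one' := by simp [pdot_zero]
  map_add_eq_mul' a b := by
    simp only [pdot_add, mul_add, Complex.exp_add]

/-- Unfolding the Bloch character. [folklore] -/
theorem blochChar_apply (p : Fin d → ℂ) (a : Site d) : blochChar p a = cexp (I * ∑ μ, p μ * (a μ : ℂ)) := rfl

/-- Real quasi-momenta give UNITARY characters. [folklore] -/
theorem norm_blochChar_real (p : Fin d → ℝ) (a : Site d) : ‖blochChar (fun μ => (p μ : ℂ)) a‖ = 1 := by
  rw [blochChar_apply]
  have : I * ∑ μ, ((p μ : ℝ) : ℂ) * (a μ : ℂ) = ((∑ μ, p μ * (a μ : ℝ) : ℝ) : ℂ) * I := by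
    push_cast; ring
  rw [this, Complex.norm_exp_ofReal_mul_I]

variable [NeZero N]

/-- **THE TRIGONOMETRIC-POLYNOMIAL SYMBOL.**  For every complex quasi-momentum `p`,
`𝕃(p) := fibreMatrix (blochChar p) = Σ_{q ∈ [−3,3]^d} exp (i p·q) • L_q` — entire and `2π`-periodic in each
`p_μ`. [folklore] -/
theorem fibreMatrix_blochChar (p : Fin d → ℂ) :
    fibreMatrix (N := N) (⇑(blochChar p)) = ∑ q ∈ stencil d, cexp (I * ∑ μ, p μ * (q μ : ℂ)) • pieceMatrix q :=
  fibreMatrix_eq_sum _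

/-- **NON-SINGULARITY ON THE REAL TORUS.**  For every real quasi-momentum the fibre matrix has non-zero
determinant (`blochFibre_uniqueness`). [folklore] -/
theorem det_fibreMatrix_blochChar_ne_zero (p : Fin d → ℝ) :
    (fibreMatrix (N := N) (⇑(blochChar (fun μ => (p μ : ℂ))))).det ≠ 0 :=
  det_fibreMatrix_ne_zero _ (norm_blochChar_real p)

/-- The same with the momentum presented as `p : Fin d → ℂ` with real entries. [folklore] -/
theorem det_fibreMatrix_blochChar_ne_zero' {p : Fin d → ℂ} (hp : ∀ μ, (p μ).im = 0) :
    (fibreMatrix (N := N) (⇑(blochChar p))).det ≠ 0 := by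
  have : p = fun μ => ((p μ).re : ℂ) := by
    funext μ; apply Complex.ext <;> simp [hp μ]
  rw [this]
  exact det_fibreMatrix_blochChar_ne_zero _

/-- Injectivity form (the hypothesis shape of `FibreInverseDecay.trigPolySymbol_inv_decay_of_injective`). [folklore] -/
theorem mulVec_fibreMatrix_blochChar_injective (p : Fin d → ℝ) :
    Function.Injective (fibreMatrix (N := N) (⇑(blochChar (fun μ => (p μ : ℂ))))).mulVec :=
  Matrix.mulVec_injective_iff_isUnit.2 (isUnit_fibreMatrix _ (norm_blochChar_real p))

end BlochChar

/-! ## §8 Translation covariance: the residual of a configuration on the box of block `y` -/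

section Translate

variable [NeZero N]

/-- The configuration seen from block `y`. [folklore] -/
def shiftCfg (U : Cfg d N) (y : Site d) : Cfg d N := fun q => U (y + q)

/-- The 1-form of the shifted configuration is the `N•y`-translate. [folklore] -/
theorem cfgA_shiftCfg (U : Cfg d N) (y : Site d) (κ : Fin d) (x : Site d) :
    cfgA (shiftCfg U y) κ x = cfgA U κ (x + (N : ℤ) • y) := by
  simp only [cfgA, shiftCfg, quo_add_zsmul, proj_add_zsmul]
  rw [add_comm (quo N x) y]

/-- The gauge multiplier of the shifted configuration is the `N•y`-translate. [folklore] -/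
theorem cfgμ_shiftCfg (U : Cfg d N) (y : Site d) (x : Site d) :
    cfgμ (shiftCfg U y) x = cfgμ U (x + (N : ℤ) • y) := by
  simp only [cfgμ, shiftCfg, quo_add_zsmul, proj_add_zsmul]
  rw [add_comm (quo N x) y]

omit [NeZero N] in
/-- The constraint multiplier of the shifted configuration is the `y`-translate. [folklore] -/
theorem cfgφ_shiftCfg (U : Cfg d N) (y : Site d) (κ : Fin d) (q : Site d) :
    cfgφ (shiftCfg U y) κ q = cfgφ U κ (q + y) := by
  simp only [cfgφ, shiftCfg]
  rw [add_comm q y]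

/-- `dz` commutes with translations. [folklore] -/
theorem dz_translate (f : Form0 d ℂ) (w : Site d) :
    dz (fun x => f (x + w)) = fun κ x => dz f κ (x + w) := by
  funext κ x; simp only [dz]; rw [add_right_comm]

/-- `codiff₁` commutes with translations. [folklore] -/
theorem codiff₁_translate (A : Form1 d ℂ) (w : Site d) :
    codiff₁ (fun κ x => A κ (x + w)) = fun x => codiff₁ A (x + w) := by
  funext x; simp only [codiff₁]
  refine Finset.sum_congr rfl (fun κ _ => ?_)
  rw [sub_add_eq_add_sub]

/-- `curv` commutes with translations. [folklore] -/
theorem curv_translate (A : Form1 d ℂ) (w : Site d) :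
    curv (fun κ x => A κ (x + w)) = fun κ l x => curv A κ l (x + w) := by
  funext κ l x; simp only [curv]; rw [add_right_comm x (unitVec κ) w, add_right_comm x (unitVec l) w]

/-- `curvAdj` commutes with translations. [folklore] -/
theorem curvAdj_translate (F : Form2 d ℂ) (w : Site d) :
    curvAdj (fun κ l x => F κ l (x + w)) = fun μ x => curvAdj F μ (x + w) := by
  funext μ x; simp only [curvAdj]
  congr 1
  · refine Finset.sum_congr rfl (fun l _ => ?_); rw [sub_add_eq_add_sub]
  · refine Finset.sum_congr rfl (fun κ _ => ?_); rw [sub_add_eq_add_sub]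

/-- `adjContourSum N` intertwines coarse translation by `y` with fine translation by `N•y`. [folklore] -/
theorem adjContourSum_translate (φ : Form1 d ℂ) (y : Site d) (κ : Fin d) (x : Site d) :
    adjContourSum N (fun l q => φ l (q + y)) κ x = adjContourSum N φ κ (x + (N : ℤ) • y) := by
  rw [adjContourSum_apply, adjContourSum_apply]
  refine Finset.sum_congr rfl (fun s _ => ?_)
  rw [show x + (N : ℤ) • y - (s : ℤ) • unitVec κ = (x - (s : ℤ) • unitVec κ) + (N : ℤ) • y by abel, quo_add_zsmul]

omit [NeZero N] in
/-- `contourSum N` on block `y` is `contourSum N` on block `0` of the `N•y`-translate. [folklore] -/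
theorem contourSum_translate (A : Form1 d ℂ) (y : Site d) (κ : Fin d) :
    contourSum N (fun l x => A l (x + (N : ℤ) • y)) κ 0 = contourSum N A κ y := by
  simp only [contourSum, smul_zero, zero_add]
  refine Finset.sum_congr rfl (fun b _ => Finset.sum_congr rfl (fun s _ => ?_))
  congr 1; abel

omit [NeZero N] in
/-- `blockSum N` on block `y` is `blockSum N` on block `0` of the `N•y`-translate. [folklore] -/
theorem blockSum_translate (f : Form0 d ℂ) (y : Site d) :
    blockSum N (fun x => f (x + (N : ℤ) • y)) 0 = blockSum N f y := by
  simp only [blockSum, smul_zero, zero_add]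
  refine Finset.sum_congr rfl (fun b _ => ?_)
  congr 1; abel

/-- EL curvature term of a translate. [folklore] -/
theorem curvAdj_curv_translate (A : Form1 d ℂ) (w : Site d) (μ : Fin d) (x : Site d) :
    curvAdj (curv (fun κ x => A κ (x + w))) μ x = curvAdj (curv A) μ (x + w) := by
  simp only [curv_translate, curvAdj_translate]

/-- EL gauge-multiplier term of a translate. [folklore] -/
theorem dz_codiff₁_dz_translate (f : Form0 d ℂ) (w : Site d) (κ : Fin d) (x : Site d) :
    dz (codiff₁ (dz (fun x => f (x + w)))) κ x = dz (codiff₁ (dz f)) κ (x + w) := by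
  simp only [dz_translate, codiff₁_translate]

/-- Gauge quantity of a translate. [folklore] -/
theorem codiff₁_dz_codiff₁_translate (A : Form1 d ℂ) (w : Site d) (x : Site d) :
    codiff₁ (dz (codiff₁ (fun κ x => A κ (x + w)))) x = codiff₁ (dz (codiff₁ A)) (x + w) := by
  simp only [codiff₁_translate, dz_translate]

/-- Every fine point is a box point of its block: `x = repZ (proj N x) + N • quo N x`. [folklore] -/
theorem eq_repZ_add_zsmul_quo (x : Site d) : x = repZ (Torus.proj N x) + (N : ℤ) • quo N x := by
  have h1 := LatticeForm.red_add_smul_quo N x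
  have h2 : LatticeForm.red N x = repZ (Torus.proj N x) := by
    funext j
    simp only [LatticeForm.red, repZ, Torus.proj_apply]
    rw [ZMod.val_intCast]
  rw [← h2]; exact h1.symm

/-- **THE BLOCK OPERATOR AT BLOCK `y`**: `cfgFun (shiftCfg U y) = Σ_{a ∈ [−3,3]^d} L_a (U (y + a))` — the convention
`(𝕃U)(y) = Σ_{a ∈ S} L_a U(y + a)` of `FibreInverseDecay.fundamental_left`. [folklore] -/
theorem cfgFun_shiftCfg_eq_sum (U : Cfg d N) (y : Site d) :
    cfgFun (shiftCfg U y) = ∑ a ∈ stencil d, (pieceMatrix a).mulVec (U (y + a)) :=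
  cfgFun_eq_sum _

/-- EL rows at block `y` are the Euler–Lagrange residual at the fine points `N•y + repZ z`. [folklore] -/
theorem cfgFun_shiftCfg_inl (U : Cfg d N) (y : Site d) (κ : Fin d) (z : TorusSite d N) :
    cfgFun (shiftCfg U y) (Sum.inl (κ, z))
      = curvAdj (curv (cfgA U)) κ (repZ z + (N : ℤ) • y) - adjContourSum N (cfgφ U) κ (repZ z + (N : ℤ) • y)
        - dz (codiff₁ (dz (cfgμ U))) κ (repZ z + (N : ℤ) • y) := by
  have hA : cfgA (shiftCfg U y) = fun κ x => cfgA U κ (x + (N : ℤ) • y) := by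
    funext κ x; exact cfgA_shiftCfg U y κ x
  have hμ : cfgμ (shiftCfg U y) = fun x => cfgμ U (x + (N : ℤ) • y) := by
    funext x; exact cfgμ_shiftCfg U y x
  have hφ : cfgφ (shiftCfg U y) = fun κ q => cfgφ U κ (q + y) := by
    funext κ q; exact cfgφ_shiftCfg U y κ q
  simp only [cfgFun, resid_inl]
  rw [hA, hμ, hφ, curvAdj_curv_translate, adjContourSum_translate, dz_codiff₁_dz_translate]

/-- G rows at block `y` (`z ≠ 0`) compare the gauge quantity at `N•y + repZ z` and at `N•y`; the M row (`z = 0`) is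
the block sum of `μ` over block `y`. [folklore] -/
theorem cfgFun_shiftCfg_inr_inl (U : Cfg d N) (y : Site d) (z : TorusSite d N) :
    cfgFun (shiftCfg U y) (Sum.inr (Sum.inl z))
      = if z = 0 then blockSum N (cfgμ U) y
        else codiff₁ (dz (codiff₁ (cfgA U))) (repZ z + (N : ℤ) • y) - codiff₁ (dz (codiff₁ (cfgA U))) ((N : ℤ) • y) := by
  have hA : cfgA (shiftCfg U y) = fun κ x => cfgA U κ (x + (N : ℤ) • y) := by
    funext κ x; exact cfgA_shiftCfg U y κ x
  have hμ : cfgμ (shiftCfg U y) = fun x => cfgμ U (x + (N : ℤ) • y) := by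
    funext x; exact cfgμ_shiftCfg U y x
  simp only [cfgFun, resid_inr_inl]
  rw [hA, hμ, blockSum_translate, codiff₁_dz_codiff₁_translate, codiff₁_dz_codiff₁_translate, zero_add]

/-- Q rows at block `y` are the block averages of `A` over block `y`. [folklore] -/
theorem cfgFun_shiftCfg_inr_inr (U : Cfg d N) (y : Site d) (κ : Fin d) :
    cfgFun (shiftCfg U y) (Sum.inr (Sum.inr κ)) = contourSum N (cfgA U) κ y := by
  have hA : cfgA (shiftCfg U y) = fun κ x => cfgA U κ (x + (N : ℤ) • y) := by
    funext κ x; exact cfgA_shiftCfg U y κ x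
  simp only [cfgFun, resid_inr_inr]
  rw [hA, contourSum_translate]

end Translate

/-! ## §9 Junction with `FibreInverseDecay` (dimension `d + 1`): decay of the inverse kernel and the fundamental
configuration -/

section Junction

open FibreInverseDecay (trigPolySymbol invKernel)
open Literature.MathematicalPhysics.QuantumFieldTheory.Balaban1983to89.B4Strip (ofRealVec)
open Literature.MathematicalPhysics.QuantumFieldTheory.Balaban1983to89.B4ContourShift (BZ supNorm)

variable [NeZero N]

/-- `fibreMatrix (blochChar p)` IS `FibreInverseDecay.trigPolySymbol (stencil (d+1)) pieceMatrix p`. [folklore] -/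
theorem fibreMatrix_blochChar_eq_trigPolySymbol (p : Fin (d + 1) → ℂ) :
    fibreMatrix (N := N) (⇑(blochChar p)) = trigPolySymbol (stencil (d + 1)) (pieceMatrix (N := N)) p := by
  rw [fibreMatrix_blochChar]
  simp only [FibreInverseDecay.trigPolySymbol, FibreInverseDecay.cphase]

/-- Hence the symbol is non-singular on the real zone (indeed at every real momentum). [folklore] -/
theorem det_trigPolySymbol_ne_zero (s : Fin (d + 1) → ℝ) :
    (trigPolySymbol (stencil (d + 1)) (pieceMatrix (N := N)) (ofRealVec s)).det ≠ 0 := by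
  rw [← fibreMatrix_blochChar_eq_trigPolySymbol]
  exact det_fibreMatrix_blochChar_ne_zero s

/-- **DECAY OF THE INVERSE KERNEL** (`FibreInverseDecay.invKernel_decay` applied to this system): the matrix
kernel `K(x) = (2π)^{-(d+1)} ∫ 𝕃(p)⁻¹ e^{ip·x} dp` decays exponentially in the sup norm. [folklore] -/
theorem invKernel_fibre_decay :
    ∃ κ M : ℝ, 0 < κ ∧ 0 ≤ M ∧ ∀ i j (x : Fin (d + 1) → ℤ),
      ‖invKernel (stencil (d + 1)) (pieceMatrix (N := N)) x i j‖ ≤ M * Real.exp (-(κ * supNorm x)) :=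
  FibreInverseDecay.invKernel_decay _ _ (fun s _ => det_trigPolySymbol_ne_zero s)

/-- The same in the `ℓ¹` norm (the cell's `Decay510` shape). [folklore] -/
theorem invKernel_fibre_decay_l1 :
    ∃ δ M : ℝ, 0 < δ ∧ 0 ≤ M ∧ ∀ i j (x : Fin (d + 1) → ℤ),
      ‖invKernel (stencil (d + 1)) (pieceMatrix (N := N)) x i j‖ ≤ M * Real.exp (-(δ * ∑ μ, |(x μ : ℝ)|)) :=
  FibreInverseDecay.invKernel_decay_l1 _ _ (fun s _ => det_trigPolySymbol_ne_zero s)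

/-- The fundamental-solution identity for this system: `Σ_{a ∈ [−3,3]^{d+1}} L_a K(x + a) = δ_{x,0} 1`. [folklore] -/
theorem fibre_fundamental_left (x : Fin (d + 1) → ℤ) :
    ∑ a ∈ stencil (d + 1), pieceMatrix (N := N) a * invKernel (stencil (d + 1)) (pieceMatrix (N := N)) (x + a)
      = if x = 0 then 1 else 0 :=
  FibreInverseDecay.fundamental_left _ _ (fun s _ => det_trigPolySymbol_ne_zero s) x

/-- THE FUNDAMENTAL CONFIGURATION with source `e`: block `q` carries `K(q) e`. [folklore] -/
def fundCfg (e : Idx (d + 1) N → ℂ) : Cfg (d + 1) N :=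
  fun q => (invKernel (stencil (d + 1)) (pieceMatrix (N := N)) q).mulVec e

/-- **THE FUNDAMENTAL CONFIGURATION SOLVES THE BLOCK SYSTEM WITH A DELTA SOURCE**: its residual on block `y` is
`e` for `y = 0` and `0` otherwise. [folklore] -/
theorem cfgFun_fundCfg (e : Idx (d + 1) N → ℂ) (y : Site (d + 1)) :
    cfgFun (shiftCfg (fundCfg (N := N) e) y) = if y = 0 then e else 0 := by
  rw [cfgFun_shiftCfg_eq_sum]
  have : ∀ a ∈ stencil (d + 1), (pieceMatrix (N := N) a).mulVec (fundCfg e (y + a))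
      = (pieceMatrix (N := N) a * invKernel (stencil (d + 1)) (pieceMatrix (N := N)) (y + a)).mulVec e := by
    intro a _
    simp only [fundCfg]
    rw [Matrix.mulVec_mulVec]
  rw [Finset.sum_congr rfl this, ← Matrix.sum_mulVec, fibre_fundamental_left]
  split_ifs
  · exact Matrix.one_mulVec e
  · exact Matrix.zero_mulVec e

/-- … read back on `ℤ^{d+1}`: with a source supported on the Q rows (`e` vanishing on the EL, G, M rows) the fields
of the fundamental configuration satisfy the Euler–Lagrange equation everywhere, have block-constant gauge quantity,
block-mean-free `μ`, and block averages `contourSum N A κ y = δ_{y,0} e (Q row κ)`. [folklore] -/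
theorem fundCfg_solves (e : Idx (d + 1) N → ℂ) (hEL0 : ∀ κ z, e (Sum.inl (κ, z)) = 0)
    (hGM0 : ∀ z, e (Sum.inr (Sum.inl z)) = 0) :
    curvAdj (curv (cfgA (fundCfg (N := N) e)))
        = adjContourSum N (cfgφ (fundCfg (N := N) e)) + dz (codiff₁ (dz (cfgμ (fundCfg (N := N) e))))
    ∧ (∀ (y : Site (d + 1)) (z : TorusSite (d + 1) N),
        codiff₁ (dz (codiff₁ (cfgA (fundCfg (N := N) e)))) (repZ z + (N : ℤ) • y)
          = codiff₁ (dz (codiff₁ (cfgA (fundCfg (N := N) e)))) ((N : ℤ) • y))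
    ∧ (∀ y : Site (d + 1), blockSum N (cfgμ (fundCfg (N := N) e)) y = 0)
    ∧ (∀ (κ : Fin (d + 1)) (y : Site (d + 1)),
        contourSum N (cfgA (fundCfg (N := N) e)) κ y = if y = 0 then e (Sum.inr (Sum.inr κ)) else 0) := by
  have hrow : ∀ (y : Site (d + 1)) (i : Idx (d + 1) N),
      cfgFun (shiftCfg (fundCfg (N := N) e) y) i = (if y = 0 then e else 0) i := fun y i => by
    rw [cfgFun_fundCfg]
  refine ⟨?_, ?_, ?_, ?_⟩
  · funext κ x
    -- write x = repZ z + N • y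
    have hx : x = repZ (Torus.proj N x) + (N : ℤ) • quo N x := eq_repZ_add_zsmul_quo x
    have h := hrow (quo N x) (Sum.inl (κ, Torus.proj N x))
    rw [cfgFun_shiftCfg_inl, ← hx] at h
    have h0 : (if quo N x = 0 then e else 0) (Sum.inl (κ, Torus.proj N x)) = 0 := by
      split_ifs <;> simp [hEL0]
    rw [h0] at h
    simp only [Pi.add_apply]
    linear_combination h
  · intro y z
    by_cases hz : z = 0
    · subst hz; rw [repZ_zero, zero_add]
    · have h := hrow y (Sum.inr (Sum.inl z))
      rw [cfgFun_shiftCfg_inr_inl, if_neg hz] at h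
      have h0 : (if y = 0 then e else 0) (Sum.inr (Sum.inl z)) = 0 := by
        split_ifs <;> simp [hGM0]
      rw [h0] at h
      exact sub_eq_zero.1 h
  · intro y
    have h := hrow y (Sum.inr (Sum.inl 0))
    rw [cfgFun_shiftCfg_inr_inl, if_pos rfl] at h
    have h0 : (if y = 0 then e else 0) (Sum.inr (Sum.inl (0 : TorusSite (d + 1) N))) = 0 := by
      split_ifs <;> simp [hGM0]
    rw [h0] at h
    exact h
  · intro κ y
    have h := hrow y (Sum.inr (Sum.inr κ))
    rw [cfgFun_shiftCfg_inr_inr] at h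
    rw [h]
    split_ifs <;> simp

end Junction

end Literature.MathematicalPhysics.QuantumFieldTheory.Balaban1983to89.Beta.BlochFibreMatrix

end
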